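import Summits.HodgeConjecture.HodgeConjecture.Theses.BoundaryReadout
import Summits.HodgeConjecture.HodgeConjecture.Theses.QbarEnvelope
import Literature.AlgebraicGeometry.HodgeTheory.AlgebraicClassesPullback
import Literature.AlgebraicGeometry.HodgeTheory.AlgebraicCyclesDefinedOverQbar
import Literature.AlgebraicGeometry.HodgeTheory.SupportedClassesGysinSpan
import HarnessLib

/-!
# Crux `PullbackAlgebraic` (stmt-HodgeConjecture-1071): the deformation to the normal cone WITHOUT a
# specialisation line — the CONSTANT LIFT composition (two stubs: deformation datum + section pull-back)

Work item stmt-HodgeConjecture-1071 (`BoundaryReadout.PullbackAlgebraic` = `QbarEnvelope.PullbackAlgebraic`;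
Fulton 1998, Cor. 19.2 (b)). The registered skeleton `Cruxes/PullbackAlgebraic/Lines/normal_cone.lean`
specialises a class `c ∈ Nᵖ H²ᵖ(Y)` dying off `Z` along the deformation space `M → Y × T` of a closed
immersion `i : X ↪ Y` by LIFTING `c` to a class on `M` dying off the flat closure `Z̄`
(`stub_specializationLine`: `e^* cl(Z̄) = mult · cl(Z)`, `mult ≥ 1` — a multiplicity statement). This
file proves that the lift can be taken CONSTANT, which removes that stub (and the fibre embedding `e`,
its retraction `ρ`, and the clauses `e⁻¹ Z̄ = Z`, `Z̄ ⊄ e(Y)`, `Z̄` irreducible of the datum):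

Let `φ : M → Y` be the structure map of the deformation space (blow-down followed by `pr_Y`),
`J : X ⊗ T → M` the strict transform of `X × T` with `ι_{t₀} ≫ J ≫ φ = i`, `k : E → M` the exceptional
divisor with projection `q : E → X` and section `s` (`s ≫ k = ι_{t₁} ≫ J`), and suppose
`φ⁻¹ Z ⊆ Z̄ ∪ k(E)` with `Z̄` closed of codimension `≥ p` in `M` and `k⁻¹ Z̄` of codimension `≥ p` in `E`.
Then for `c` dying off `Z`:

* `C := φ^* c` dies off `Z̄ ∪ k(E)`; by Deligne (Hodge III, Cor. 8.2.8) and Hironaka — the tree's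
  theorems `Deligne1974_ker_restrictCompl_eq_iSup_range_complexGysin_holds`,
  `exists_family_iUnion_range_eq_of_isClosed` — `C = w + v` with `w` dying off `Z̄` (a sum of Gysin
  images of desingularisations of the components of `Z̄`) and `v = k_* u` dying off `k(E)`;
* `i^* c = (ι_{t₀} ≫ J)^* C = (ι_{t₀} ≫ J)^* w`, because `ι_{t₀} ≫ J` misses `k(E)` (so `(ι_{t₀} ≫ J)^* v`
  dies off `∅`, hence vanishes);
* `(ι_{t₀} ≫ J)^* w = (ι_{t₁} ≫ J)^* w = s^* (k^* w)` by the homotopy invariance of slices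
  (`complexBetti_map_sliceAt_eq_of_pathConnectedSpace`), and `k^* w` dies off `k⁻¹ Z̄`, of codimension
  `≥ p` in `E`, so `k^* w ∈ Nᵖ H²ᵖ(E)` and `s^*(k^* w) ∈ Nᵖ H²ᵖ(X)` by the section pull-back
  (`stub_sectionPullback`, proved in the skeleton from its four sub-stubs, two of them landed).

No multiplicity, no purity, no non-vanishing is used. PROVED here (no `sorry`; the two remaining
inputs are hypotheses with the binders displayed below):

* `map_eq_zero_of_disjoint` — a class dying off `k(E)` pulls back to `0` along a morphism from a
  smooth projective variety missing `k(E)`;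
* `ker_le_comap_of_constantLift` — the closed-immersion case from the two hypotheses;
* `PullbackAlgebraic_of_constantLift` / `boundaryReadout_pullbackAlgebraic_of_constantLift` — **the crux
  (both route decls) from the CONSTANT-LIFT DATUM and the SECTION PULL-BACK** (graph reduction as in the
  skeleton: `complexBetti_map_lift_id_map_snd`, `map_snd_mem_supportedClasses`).

The constant-lift datum (hypothesis `hD`) is the registered `stub_deformationDatum` with `e, ρ` replaced
by `φ : M ⟶ Y`, the clause `i ≫ e = ι_{t₀} ≫ J` by `ι_{t₀} ≫ J ≫ φ = i`, the clauses on `Z̄` by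
`φ⁻¹ Z ⊆ Z̄ ∪ k(E)` + codimension bookkeeping (no irreducibility), plus the disjointness
`(ι_{t₀} ≫ J)(X) ∩ k(E) = ∅`; all of these hold for `M = Bl_{X × t₁}(Y × ℙ¹)` trivially.

## References

* [Fulton1998] W. Fulton, Intersection Theory, 2nd ed. (1998), §5.1, §6.2, Ex. 19.2.1, Cor. 19.2 (b).
* [DeligneHodgeIII1974] P. Deligne, Théorie de Hodge III, Cor. 8.2.8.
* [VoisinHodgeII2003] C. Voisin, Hodge Theory and Complex Algebraic Geometry II (2003), Prop. 9.21 (i).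
* [Kollar2007] J. Kollár, Lectures on Resolution of Singularities (2007), Thm. 3.27.
-/

noncomputable section

-- every declaration of this problem lives in `Summit.HodgeConjecture.HodgeConjecture.…` (summit = sub-problem)
set_option linter.dupNamespace false

namespace Summit.HodgeConjecture.HodgeConjecture.Theorems

open CategoryTheory AlgebraicGeometry MonoidalCategory CartesianMonoidalCategory
open Literature.AlgebraicGeometry Literature.AlgebraicGeometry.Motives
open Literature.AlgebraicGeometry.HodgeTheory
open Literature.AlgebraicTopology.SingularHomology (gysinMap_restrictCompl_eq_zero_of_field)

/-! ### The two hypotheses (section variables; displayed as binders of the theorems below)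

* `hD` — **the constant-lift deformation datum** (Fulton 1998 §5.1: `T = ℙ¹`,
  `M = Bl_{i(X) × {t₁}}(Y ⊗ T)`, `φ` = blow-down followed by `pr_Y`, `J` = strict transform of `X × T`,
  `E` = exceptional divisor `ℙ(N ⊕ 𝟙)` with projection `q` and section `s` at infinity,
  `Z̄ Z` = closure of `β⁻¹(Z × T) ∖ E`). For a closed immersion `i : X ↪ Y` of smooth projective complex
  varieties (`dim Y = dim X + r`, `r ≥ 1`): a smooth projective curve `T` with two complex points, a smooth
  projective `M` of dimension `n + r + 1` with `φ : M ⟶ Y`, `J : X ⊗ T ⟶ M` with `ι_{t₀} ≫ J ≫ φ = i`, a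
  smooth projective `E` of dimension `n + r` with `k : E ⟶ M`, `q : E ⟶ X` Zariski-locally over `X` a
  product `U × ℙʳ`, a section `s` (`s ≫ q = 𝟙`, `s ≫ k = ι_{t₁} ≫ J`), the slice `ι_{t₀} ≫ J` missing
  `k(E)`, and for every Zariski-closed `Z ⊆ Y` a Zariski-closed `Z̄ ⊆ M` with `φ⁻¹ Z ⊆ Z̄ ∪ k(E)` which
  has codimension `≥ p` in `M` and trace `k⁻¹ Z̄` of codimension `≥ p` in `E` whenever `Z` has
  codimension `≥ p`;
* `hSec` — **the section pull-back** (= the skeleton's former `stub_sectionPullback`, now its theorem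
  `sectionPullback_of` from four sub-stubs): the section of a Zariski-locally trivial `ℙʳ`-bundle of
  smooth projective varieties pulls algebraic classes back to algebraic classes. -/

/-! ### Lemmas -/

section Lemmas

variable {n : ℕ} {X : SchemeOver ℂ}

/-- A class dying off the EMPTY set vanishes (restriction to `(X ∖ ∅)(ℂ) = X(ℂ)` is injective on a
smooth projective `X`: semipurity with an arbitrary codimension bound). [cite: GrothendieckTopology1969, §1] -/
theorem eq_zero_of_restrictCompl_empty_eq_zero (hX : IsSmoothProjective n X) {a : ℕ}
    {x : complexBetti X a} (hx : complexBetti.restrictCompl X ∅ a x = 0) : x = 0 :=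
  injective_restrictCompl_of_le_coheight hX isClosed_empty (c := a + 1)
    (fun z hz ↦ (Set.notMem_empty z hz).elim) (i := a) (by omega) (by rw [hx, map_zero])

/-- **A class dying off `k(E)` pulls back to zero along a morphism missing `k(E)`.**
[cite: GrothendieckTopology1969, §1] -/
theorem map_eq_zero_of_disjoint (hX : IsSmoothProjective n X) {M : SchemeOver ℂ} (g : X ⟶ M)
    {S : Set M.left} (hS : Disjoint (Set.range g.left.base) S) {a : ℕ} {v : complexBetti M a}
    (hv : complexBetti.restrictCompl M S a v = 0) : complexBetti.map g a v = 0 := by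
  refine eq_zero_of_restrictCompl_empty_eq_zero hX ?_
  have h := complexBetti.restrictCompl_map_eq_zero g hv
  have he : g.left.base ⁻¹' S = ∅ :=
    Set.eq_empty_of_forall_notMem fun x hx ↦ Set.disjoint_left.1 hS (Set.mem_range_self x) hx
  rwa [he] at h

/-- **Deligne's decomposition, support form**: on a smooth projective `M`, a class dying off
`Z̄ ∪ k(E)` (`Z̄` Zariski-closed of codimension `≥ p`, `k : E ⟶ M` from a smooth projective `E`) is the
sum of a class dying off `Z̄` and a class dying off `k(E)` — resolve the components of `Z̄`
(`exists_family_iUnion_range_eq_of_isClosed`, Hironaka) and decompose by Deligne's Cor. 8.2.8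
(`Deligne1974_ker_restrictCompl_eq_iSup_range_complexGysin_holds`); each Gysin image dies off the range
of its morphism. [cite: DeligneHodgeIII1974, Cor. 8.2.8] [cite: Kollar2007, Thm. 3.27] -/
theorem exists_add_of_restrictCompl_union_range_eq_zero {N dE : ℕ} {M E : SchemeOver ℂ}
    (hM : IsSmoothProjective N M) (hE : IsSmoothProjective dE E) (k : E ⟶ M) {Zb : Set M.left}
    (hZbc : IsClosed Zb) {p : ℕ} (hZbp : ∀ w ∈ Zb, (p : ℕ∞) ≤ Order.coheight w) {a : ℕ}
    {C : complexBetti M a} (hC : complexBetti.restrictCompl M (Zb ∪ Set.range k.left.base) a C = 0) :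
    ∃ w v : complexBetti M a, C = w + v ∧ complexBetti.restrictCompl M Zb a w = 0 ∧
      complexBetti.restrictCompl M (Set.range k.left.base) a v = 0 := by
  classical
  let μ : OrientationFamily := fun _ _ h ↦ (Motives.ComplexPoints.isOrientableOver ℂ h).some
  have hμ : μ.HasPoincareDuality := OrientationFamily.hasPoincareDuality μ
  have hS := gysinMap_restrictCompl_eq_zero_of_field ℂ
  obtain ⟨ι, _, m, Y, hY, g, hZeq, -⟩ :=
    exists_family_iUnion_range_eq_of_isClosed Resolution.Hironaka1964_projective_holds hM hZbc hZbp
  -- the family `Option ι`: `none ↦ (E, k)`, `some j ↦ (Y j, g j)`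
  let m' : Option ι → ℕ := fun o ↦ o.elim dE m
  let Y' : Option ι → SchemeOver ℂ := fun o ↦ o.rec E Y
  have hY' : ∀ o, IsSmoothProjective (m' o) (Y' o) := fun o ↦ by cases o with
    | none => exact hE
    | some j => exact hY j
  let g' : ∀ o, Y' o ⟶ M := fun o ↦ match o with
    | none => k
    | some j => g j
  have hU : (⋃ o, Set.range (g' o).left.base) = Zb ∪ Set.range k.left.base := by
    ext x
    simp only [Set.mem_iUnion, Set.mem_union]
    constructor
    · rintro ⟨o, ho⟩
      cases o with
      | none => exact Or.inr ho
      | some j => exact Or.inl (hZeq ▸ Set.mem_iUnion.2 ⟨j, ho⟩)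
    · rintro (hx | hx)
      · rw [← hZeq] at hx
        obtain ⟨j, hj⟩ := Set.mem_iUnion.1 hx
        exact ⟨some j, hj⟩
      · exact ⟨none, hx⟩
  have hC' : complexBetti.restrictCompl M (⋃ o, Set.range (g' o).left.base) a C = 0 := by
    rw [hU]; exact hC
  have hmem := Deligne1974_ker_restrictCompl_eq_iSup_range_complexGysin_holds.mem_iSup_range μ hμ
    hM hY' g' hC'
  -- each Gysin image dies off the range of its morphism
  have hle : (⨆ (o : Option ι) (b : ℕ) (hab : b + 2 * N = a + 2 * m' o),
      LinearMap.range (complexGysin μ (hY' o) hM (g' o) hab)) ≤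
      LinearMap.ker (complexBetti.restrictCompl M Zb a).hom ⊔
        LinearMap.ker (complexBetti.restrictCompl M (Set.range k.left.base) a).hom := by
    refine iSup_le fun o ↦ iSup_le fun b ↦ iSup_le fun hab ↦ ?_
    rintro _ ⟨y, rfl⟩
    have hcl : IsClosed (Set.range (g' o).left.base) := by
      haveI := isProper_left_of_isSmoothProjective (hY' o) hM (g' o)
      exact (g' o).left.isClosedMap.isClosed_range
    have hdie : complexBetti.restrictCompl M (Set.range (g' o).left.base) a
        (complexGysin μ (hY' o) hM (g' o) hab y) = 0 :=
      complexGysin_restrictCompl_eq_zero hS μ hμ (hY' o) hM (g' o) hab hcl y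
        (restrictCompl_eq_zero_of_preimage_eq_univ (Set.preimage_range _) _ _)
    cases o with
    | none => exact Submodule.mem_sup_right (LinearMap.mem_ker.2 hdie)
    | some j =>
      refine Submodule.mem_sup_left (LinearMap.mem_ker.2 ?_)
      refine complexBetti.restrictCompl_eq_zero_of_subset ?_ hdie
      rw [← hZeq]
      exact Set.subset_iUnion (fun j ↦ Set.range (g j).left.base) j
  obtain ⟨w, hw, v, hv, hwv⟩ := Submodule.mem_sup.1 (hle hmem)
  exact ⟨w, v, hwv.symm, LinearMap.mem_ker.1 hw, LinearMap.mem_ker.1 hv⟩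

end Lemmas

/-! ### The closed-immersion case -/

section Graph

variable {X : SchemeOver ℂ}

/-- The graph `(𝟙, j) : X ⟶ X ⊗ W` of a morphism to a smooth projective (hence separated) `W` is a
closed immersion (a section of the separated projection `X ⊗ W → X`). [folklore; Stacks 01KT] -/
theorem isClosedImmersion_lift_id_left' {m : ℕ} {W : SchemeOver ℂ} (hW : IsSmoothProjective m W)
    (j : X ⟶ W) : IsClosedImmersion (CartesianMonoidalCategory.lift (𝟙 X) j).left := by
  haveI : IsProper W.hom := hW.isProjectiveOver.isProper
  have h : (CartesianMonoidalCategory.lift (𝟙 X) j).left ≫ (fst X W).left = 𝟙 _ := by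
    rw [← Over.comp_left, CartesianMonoidalCategory.lift_fst]
    rfl
  haveI : IsSeparated (fst X W).left := inferInstanceAs (IsSeparated (Limits.pullback.fst X.hom W.hom))
  haveI : IsClosedImmersion ((CartesianMonoidalCategory.lift (𝟙 X) j).left ≫ (fst X W).left) := by
    rw [h]
    infer_instance
  exact IsClosedImmersion.of_comp _ (fst X W).left

end Graph

section Composition

variable {n : ℕ} {X : SchemeOver ℂ}
  (hD : ∀ ⦃n r : ℕ⦄ ⦃X Y : SchemeOver ℂ⦄ (i : X ⟶ Y), IsSmoothProjective n X →
        IsSmoothProjective (n + r) Y → IsClosedImmersion i.left → 1 ≤ r →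
        ∃ (T : SchemeOver ℂ) (t₀ t₁ : AlgPoints T ℂ) (M E : SchemeOver ℂ) (φ : M ⟶ Y)
          (J : X ⊗ T ⟶ M) (k : E ⟶ M) (q : E ⟶ X) (s : X ⟶ E) (Zbar : Set Y.left → Set M.left),
          IsSmoothProjective 1 T ∧ IsSmoothProjective (n + r + 1) M ∧ IsSmoothProjective (n + r) E ∧
          Motives.sliceAt X t₀ ≫ J ≫ φ = i ∧ s ≫ k = Motives.sliceAt X t₁ ≫ J ∧ s ≫ q = 𝟙 X ∧
          Disjoint (Set.range (Motives.sliceAt X t₀ ≫ J).left.base) (Set.range k.left.base) ∧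
          (∀ x : X.left, ∃ U : X.left.Opens, x ∈ U ∧
            ∃ ψ : (Over.mk ((q.left ⁻¹ᵁ U).ι ≫ E.hom) : SchemeOver ℂ) ≅
                (Over.mk (U.ι ≫ X.hom) : SchemeOver ℂ) ⊗ Motives.projectiveSpace r ℂ,
              ψ.hom.left ≫ (fst (Over.mk (U.ι ≫ X.hom) : SchemeOver ℂ)
                (Motives.projectiveSpace r ℂ)).left ≫ U.ι = (q.left ⁻¹ᵁ U).ι ≫ q.left) ∧
          ∀ (p : ℕ) (Z : Set Y.left), IsClosed Z → (∀ z ∈ Z, (p : ℕ∞) ≤ Order.coheight z) →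
            IsClosed (Zbar Z) ∧ (∀ w ∈ Zbar Z, (p : ℕ∞) ≤ Order.coheight w) ∧
            φ.left.base ⁻¹' Z ⊆ Zbar Z ∪ Set.range k.left.base ∧
            ∀ w ∈ k.left.base ⁻¹' Zbar Z, (p : ℕ∞) ≤ Order.coheight w)
  (hSec : ∀ ⦃n r : ℕ⦄ ⦃X E : SchemeOver ℂ⦄ (q : E ⟶ X) (s : X ⟶ E), IsSmoothProjective n X →
        IsSmoothProjective (n + r) E → s ≫ q = 𝟙 X →
        (∀ x : X.left, ∃ U : X.left.Opens, x ∈ U ∧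
          ∃ ψ : (Over.mk ((q.left ⁻¹ᵁ U).ι ≫ E.hom) : SchemeOver ℂ) ≅
              (Over.mk (U.ι ≫ X.hom) : SchemeOver ℂ) ⊗ Motives.projectiveSpace r ℂ,
            ψ.hom.left ≫ (fst (Over.mk (U.ι ≫ X.hom) : SchemeOver ℂ)
              (Motives.projectiveSpace r ℂ)).left ≫ U.ι = (q.left ⁻¹ᵁ U).ι ≫ q.left) →
        ∀ (p : ℕ), ∀ y ∈ algebraicClasses E p,
          complexBetti.map s (2 * p) y ∈ algebraicClasses X p)

include hD hSec

/-- **The closed-immersion case from the two hypotheses.** For a closed immersion `γ : X ↪ V` of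
smooth projective varieties with `dim V = dim X + r`, `r ≥ 1`, `γ^*` maps the classes dying off a
closed `Z ⊆ V` of codimension `≥ p` into `algebraicClasses X p`: with the constant-lift datum,
`γ^* c = (ι_{t₀} ≫ J)^*(φ^* c) = (ι_{t₀} ≫ J)^* w = (ι_{t₁} ≫ J)^* w = s^*(k^* w)` for the part `w`
of `φ^* c` dying off `Z̄` (Deligne decomposition; the other part dies off `k(E)`, missed by the slice at
`t₀`), and `k^* w ∈ Nᵖ(E)`, `s^*(k^* w) ∈ Nᵖ(X)` (section pull-back).
[cite: Fulton1998, §6.2 and Ex. 19.2.1] [cite: DeligneHodgeIII1974, Cor. 8.2.8] -/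
theorem ker_le_comap_of_constantLift {r : ℕ} {V : SchemeOver ℂ} (hX : IsSmoothProjective n X)
    (hV : IsSmoothProjective (n + r) V)
    (hr : 1 ≤ r) (γ : X ⟶ V) (hγ : IsClosedImmersion γ.left) (p : ℕ) {Z : Set V.left}
    (hZc : IsClosed Z) (hZp : ∀ z ∈ Z, (p : ℕ∞) ≤ Order.coheight z) :
    LinearMap.ker (complexBetti.restrictCompl V Z (2 * p)).hom ≤
      (algebraicClasses X p).comap (complexBetti.map γ (2 * p)).hom := by
  obtain ⟨T, t₀, t₁, M, E, φ, J, k, q, s, Zbar, hT, hM, hE, hJφ, hsk, hsq, hdisj, htriv, hZbar⟩ :=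
    hD γ hX hV hγ hr
  obtain ⟨hZbc, hZbp, hsub, hZbE⟩ := hZbar p Z hZc hZp
  intro c hc
  rw [Submodule.mem_comap]
  -- the constant lift `C = φ^* c` dies off `Z̄ ∪ k(E)`
  have hC : complexBetti.restrictCompl M (Zbar Z ∪ Set.range k.left.base) (2 * p)
      (complexBetti.map φ (2 * p) c) = 0 :=
    complexBetti.restrictCompl_eq_zero_of_subset hsub
      (complexBetti.restrictCompl_map_eq_zero φ (LinearMap.mem_ker.1 hc))
  obtain ⟨w, v, hwv, hw, hv⟩ := exists_add_of_restrictCompl_union_range_eq_zero hM hE k hZbc hZbp hC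
  -- `γ^* c = (ι_{t₀} ≫ J)^* C = (ι_{t₀} ≫ J)^* w = (ι_{t₁} ≫ J)^* w = s^* (k^* w)`
  haveI : PathConnectedSpace (Motives.ComplexPoints T) :=
    pathConnectedSpace_complexPoints_of_isSmoothProjective' hT
  have key : (complexBetti.map γ (2 * p)).hom c =
      (complexBetti.map s (2 * p)).hom ((complexBetti.map k (2 * p)).hom w) := by
    have h0 : (complexBetti.map (Motives.sliceAt X t₀ ≫ J) (2 * p)).hom v = 0 :=
      map_eq_zero_of_disjoint hX (Motives.sliceAt X t₀ ≫ J) hdisj hv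
    have h0' : (complexBetti.map (Motives.sliceAt X t₀) (2 * p)).hom
        ((complexBetti.map J (2 * p)).hom v) = 0 := by
      rw [← complexBetti.map_comp_apply]; exact h0
    have hslice : complexBetti.map (Motives.sliceAt X t₀) (2 * p) =
        complexBetti.map (Motives.sliceAt X t₁) (2 * p) :=
      complexBetti_map_sliceAt_eq_of_pathConnectedSpace t₀ t₁ (2 * p)
    rw [← hJφ, complexBetti.map_comp_apply (Motives.sliceAt X t₀) (J ≫ φ),
      complexBetti.map_comp_apply J φ, hwv, map_add, map_add, h0', add_zero,
      ← complexBetti.map_comp_apply s k, hsk, complexBetti.map_comp_apply, hslice]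
  -- `k^* w` dies off `k⁻¹ Z̄`, of codimension `≥ p` in `E`
  have hkw : (complexBetti.map k (2 * p)).hom w ∈ algebraicClasses E p :=
    mem_supportedClasses_of_restrictCompl_eq_zero (hZbc.preimage k.left.continuous) hZbE
      (complexBetti.restrictCompl_map_eq_zero k hw)
  change (complexBetti.map γ (2 * p)).hom c ∈ algebraicClasses X p
  rw [key]
  exact hSec q s hX hE hsq htriv p _ hkw


/-- **The crux (primary decl `QbarEnvelope.PullbackAlgebraic`) from the constant-lift datum and the
section pull-back.** Given `ι : X ⟶ W` and `c' ∈ Nᵖ H²ᵖ(W)`: if `dim W = 0` then `H²ᵖ(W(ℂ)) = 0` for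
`p ≥ 1` and `N⁰ = ⊤`; else `ι^* c' = γ^*(pr_W^* c')` for the graph `γ = (𝟙, ι) : X ↪ X ⊗ W` (a closed
immersion of codimension `dim W ≥ 1`), `pr_W^* c' ∈ Nᵖ` (flat), and `Nᵖ H²ᵖ(X ⊗ W)` is the sum over closed
supports of kernels each handled by `ker_le_comap_of_constantLift`.
[cite: Fulton1998, §19.2 proof of Prop. 19.2 and Cor. 19.2 (b)] [cite: VoisinHodgeII2003, Prop. 9.21 (i)] -/
theorem PullbackAlgebraic_of_constantLift :
    Summit.HodgeConjecture.HodgeConjecture.Theses.QbarEnvelope.PullbackAlgebraic := by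
  intro n X hX m W hW ι p c' hc'
  rcases Nat.eq_zero_or_pos m with rfl | hm
  · rcases Nat.eq_zero_or_pos p with rfl | hp
    · rw [algebraicClasses_zero]
      exact Submodule.mem_top
    · haveI := subsingleton_complexBetti hW (k := 2 * p) (by omega)
      rw [Subsingleton.elim c' 0, map_zero]
      exact Submodule.zero_mem _
  · rw [← complexBetti_map_lift_id_map_snd ι (2 * p) c']
    have hV : IsSmoothProjective (n + m) (X ⊗ W) := IsSmoothProjective.tensor_holds hX hW
    have hc : complexBetti.map (snd X W) (2 * p) c' ∈ algebraicClasses (X ⊗ W) p :=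
      map_snd_mem_supportedClasses hX hW hc'
    have hγ : IsClosedImmersion (CartesianMonoidalCategory.lift (𝟙 X) ι).left :=
      isClosedImmersion_lift_id_left' hW ι
    suffices hle : algebraicClasses (X ⊗ W) p ≤
        (algebraicClasses X p).comap
          (complexBetti.map (CartesianMonoidalCategory.lift (𝟙 X) ι) (2 * p)).hom from hle hc
    exact iSup_le fun Z ↦ iSup_le fun hZc ↦ iSup_le fun hZp ↦
      ker_le_comap_of_constantLift hD hSec hX hV hm _ hγ p hZc hZp

/-- **The crux as the `BoundaryReadout` decl** (syntactically identical to the `QbarEnvelope` decl) from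
the constant-lift datum and the section pull-back. [cite: Fulton1998, §19.2 Cor. 19.2 (b)] -/
theorem boundaryReadout_pullbackAlgebraic_of_constantLift :
    Summit.HodgeConjecture.HodgeConjecture.Theses.BoundaryReadout.PullbackAlgebraic :=
  fun _ _ hX _ _ hW ι p c' hc' ↦ PullbackAlgebraic_of_constantLift hD hSec hX hW ι p c' hc'

end Composition

end Summit.HodgeConjecture.HodgeConjecture.Theorems

end
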